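import Summits.BirchSwinnertonDyer.BirchSwinnertonDyer.Theses.ShaPrimaryTransfer
import Summits.BirchSwinnertonDyer.BirchSwinnertonDyer.Theses.KatoTransfer
import Literature.NumberTheory.EllipticCurves.KubertTateSevenRational
import Literature.NumberTheory.EllipticCurves.LFunctionSmulProofs
import Literature.NumberTheory.EllipticCurves.AnomalousOfRationalTorsionProofs
import Literature.NumberTheory.EllipticCurves.SupersingularDensityProofs
import Literature.NumberTheory.EllipticCurves.NoEverywhereGoodReductionRat
import Literature.NumberTheory.EllipticCurves.OrdinaryPrimesProofs
import Literature.NumberTheory.EllipticCurves.PAdicLFunction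
import Literature.NumberTheory.EllipticCurves.SelmerCorankHolds
import HarnessLib

/-!
# Where the transfer `T` is IDLE, and what is left of it: one X2-admissible open door gives `r_an = rank`
# from X2 + X3 + Kato; the assembly needs `T` only FROM INADMISSIBLE door primes

Helper for item **stmt-BirchSwinnertonDyer-22356** (`FiniteShaComponentTransfer`, «T», the transfer slice)
of route `ShaPrimaryTransfer`; closes nothing by itself; **BSD is NOT proved by this file** and `T` stays
conjecture-grade at analytic rank `≥ 2`. Companion of `…AssemblyWeakTransfer` (the assembly needs only «door ⟹
admissible prime») and of `…RowAtFiveClassWide` / `…RowAtSevenClassWide` (the door primes `5`, `7` of the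
Kubert–Tate families are good ORDINARY). The bookkeeping point about `T`, in Lean:

* §0 (generic): the deciding theorem `Theses.ShaPrimaryTransfer.closes` uses `T` only to move an open door
  `t_{p₀}(E) = 0` to the good ordinary prime where X2 docks. If the door prime `p₀` is ITSELF X2-admissible
  (`p₀ ≥ 5`, good ordinary on a global minimal model) — i.e. the curve satisfies KatoTransfer's X1
  (`ShaCorankZeroAtOnePrime`, stmt-18411) with witness `p₀` — then leg 1 (`r_an ≤ s_{p₀} = rank + t_{p₀} = rank`:
  X2 + the Kummer identity, tree `selmerCorank_eq_mordellWeilRank_add_holds`) runs at `p₀` and leg 2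
  (`rank ≤ ord_T L_p ≤ r_an`: `KatoRankBound` + X3 at X3's own prime) never mentions `Ш`:
  **`analyticRank_eq_mordellWeilRank_of_admissibleDoor`** — `r_an(E) = rank E(ℚ)` from X2, X3, the Kato side
  and ONE admissible open door, with neither `T` nor `O`. This is KatoTransfer's deciding theorem
  `Theses.KatoTransfer.closes` read PER CURVE (adapted, not imported: there legs 1/2 sit inside a `∀ W` proof);
  transported to any model by `…_of_smul_eq` (`analyticRank_smul`, `mordellWeilRank_eq_of_smul_eq`,
  `shaCorank_eq_zero_iff_of_smul_eq`).
* §1 CLASS-WIDE: a rational point of prime order `p ≥ 3` at a good prime makes `p` anomalous (`a_p ≡ 1 (mod p)`,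
  tree `dvd_frobeniusTrace_sub_one_of_addOrderOf_eq`, Mazur 1972 §1), hence ORDINARY
  (`isOrdinaryAt_of_addOrderOf_eq_prime`); so **for every elliptic curve `W/ℚ` (any model) with a rational point of
  prime order `p ≥ 5`, good reduction at `p` and an open door at `p` (`t_p(W) = 0`), X2 + X3 + Kato give
  `r_an(W) = rank W(ℚ)`** (`analyticRank_eq_mordellWeilRank_of_addOrderOf_eq_prime'`; by Mazur's torsion theorem
  `p ∈ {5, 7}`: `…_of_addOrderOf_eq_five`, `…_of_addOrderOf_eq_seven`). On these classes — exactly where the tree's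
  unconditional rank-`≥ 2` doors at an admissible prime live (`μ₅`- and `μ₇`-descent on the Kubert–Tate families,
  files `KubertTateFiveMuDescentBox`, `KubertTateSevenMuDescentBox`) — the route's crux `T` and its door item
  `O` are replaced by a per-curve descent; what remains of the route there is KatoTransfer's X2 ∧ X3 ∧ Kato.
  (At `p = 3` the door prime is ordinary too, but X2/X3 ask `p ≥ 5`.)
* §2 WHAT IS LEFT OF `T`: the assembly needs the transfer only FROM INADMISSIBLE door primes (`p₀ ∈ {2,3}`, bad,
  supersingular) to admissible ones — `shaCorankZeroAtOnePrime_of_door_of_transferFromInadmissible` (that slice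
  `∧ O ⟹` KatoTransfer's X1) and **`bsd_of_transferFromInadmissible`** (`hTi → O → X2 → X3 → Kato → BSD`),
  sharpening `…AssemblyWeakTransfer.bsd_of_weakTransfer`; `closes` factors through it (`example`); weakest
  `∃`-form `shaCorankZeroAtOnePrime_of_door_of_exists_transfer` / `bsd_of_exists_transfer`.

Numbers, not adjectives: `T`'s load-bearing content for this route is «`t_{p₀}(E) = 0` at an INADMISSIBLE
`p₀` ⟹ `t_q(E) = 0` at some good ordinary `q ≥ 5`», open at analytic rank `≥ 2` (rank `≤ 1`: `…Sectors`);
under Selmer-rank BSD at good ordinary primes it is literally rank-BSD for those curves (`…OrdinaryPair`).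

## References

* [GreenbergLNM1716] R. Greenberg, *Iwasawa theory for elliptic curves*, LNM 1716, §1 (pp. 54–57).
* [Kato2004Asterisque] K. Kato, Astérisque 295 (2004), Thm. 17.4.
* [SilvermanAEC2009] J. H. Silverman, *AEC*, 2nd ed., III.3.1(b), VII.3.1(b), VII.5 Prop. 5.1, Cor. VIII.8.3,
  App. C §16.
* [Mazur1972] B. Mazur, Invent. Math. 18 (1972) 183–266, §1 (anomalous primes).
* [Serre1981] J.-P. Serre, Publ. Math. IHÉS 54 (1981), §8 (density of ordinary primes).
-/

noncomputable section

-- D-0017: single-problem summit, so `Summit.BirchSwinnertonDyer.BirchSwinnertonDyer.…` repeats a namespace BY DESIGN.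
set_option linter.dupNamespace false
set_option autoImplicit false

open WeierstrassCurve
open Literature.NumberTheory.EllipticCurves
open Summit.BirchSwinnertonDyer.BirchSwinnertonDyer.Theses.ShaPrimaryTransfer
open Summit.BirchSwinnertonDyer.BirchSwinnertonDyer.Theses.KatoTransfer (ShaCorankZeroAtOnePrime)

namespace Summit.BirchSwinnertonDyer.BirchSwinnertonDyer.Theorems.ShaPrimaryTransferAdmissibleDoor

/-! ## §0 The assembly WITHOUT the transfer: one X2-admissible open door suffices -/

/-- **`r_an(E) = rank E(ℚ)` from X2, X3, the Kato side and ONE X2-admissible open door — no transfer `T`, no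
door item `O`** (KatoTransfer's deciding theorem `Theses.KatoTransfer.closes` per curve: the admissible open door
is that curve's instance of X1 = `ShaCorankZeroAtOnePrime`). For a globally minimal elliptic `W/ℚ` and a prime
`p₀ ≥ 5` of good ordinary reduction with `t_{p₀}(W) = corank Ш(W)[p₀^∞] = 0`: leg 1 at `p₀` (X2: `r_an ≤ s_{p₀}`;
Kummer identity `s_{p₀} = rank + t_{p₀}`, tree `selmerCorank_eq_mordellWeilRank_add_holds`), leg 2 at the prime
of X3 (Kato: `rank ≤ ord_T L_p`; X3: `ord_T L_p ≤ r_an`). CONDITIONAL on the three route items `hX2`, `hX3`, `hK`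
only; proof adapted from `Theses.KatoTransfer.closes` (planner, 2026-08-17).
[cite: GreenbergLNM1716, §1 (pp. 54–57)] [cite: Kato2004Asterisque, Thm. 17.4] -/
theorem analyticRank_eq_mordellWeilRank_of_admissibleDoor (hX2 : AnalyticRankLeSelmerCorank)
    (hX3 : PadicOrderLeAnalyticRankAtOnePrime) (hK : KatoRankBound)
    (W : WeierstrassCurve ℚ) [W.IsElliptic] [W.IsGloballyMinimal] (p₀ : ℕ) [Fact p₀.Prime] (h5 : 5 ≤ p₀)
    (hgood : W.HasGoodReductionAtPrime p₀) (hord : ¬ (p₀ : ℤ) ∣ W.frobeniusTrace p₀)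
    (ht : W.shaCorank p₀ = 0) : W.analyticRank = W.mordellWeilRank := by
  -- leg 1 at the door prime itself
  have hLB : W.analyticRank ≤ W.mordellWeilRank := by
    have hid : W.selmerCorank p₀ = W.mordellWeilRank + W.shaCorank p₀ :=
      W.selmerCorank_eq_mordellWeilRank_add_holds p₀
    have h2 := hX2 W p₀ h5 hgood hord
    omega
  -- leg 2 at the prime of X3 (no `Ш` involved)
  have hUB : W.mordellWeilRank ≤ W.analyticRank := by
    obtain ⟨p, hp, h5p, hgoodp, hordp, N, hN, f, hf, hle⟩ := hX3 W
    have hp2 : p ≠ 2 := by omega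
    have hordAt : IsOrdinaryAt W p := ⟨hgoodp, hordp⟩
    have hk := hK W p hp2 hordAt f hf
    exact_mod_cast hk.trans hle
  exact le_antisymm hLB hUB

/-- **The same for ANY model**: if `C • W = V` with `V` globally minimal carrying an X2-admissible open door
`p₀` (`t_{p₀}(W) = 0`), then `r_an(W) = rank W(ℚ)` from X2 + X3 + Kato — `r_an`, rank and the vanishing of
`t_{p₀}` are carried along `C` (tree `analyticRank_smul`, `mordellWeilRank_eq_of_smul_eq`,
`shaCorank_eq_zero_iff_of_smul_eq`). CONDITIONAL on `hX2`, `hX3`, `hK` only.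
[cite: GreenbergLNM1716, §1 (pp. 54–57)] [cite: SilvermanAEC2009, III.3.1(b) and App. C §16] -/
theorem analyticRank_eq_mordellWeilRank_of_admissibleDoor_of_smul_eq (hX2 : AnalyticRankLeSelmerCorank)
    (hX3 : PadicOrderLeAnalyticRankAtOnePrime) (hK : KatoRankBound)
    (W V : WeierstrassCurve ℚ) [W.IsElliptic] [V.IsElliptic] [V.IsGloballyMinimal] (C : VariableChange ℚ)
    (hC : C • W = V) (p₀ : ℕ) [Fact p₀.Prime] (h5 : 5 ≤ p₀) (hgood : V.HasGoodReductionAtPrime p₀)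
    (hord : ¬ (p₀ : ℤ) ∣ V.frobeniusTrace p₀) (ht : W.shaCorank p₀ = 0) :
    W.analyticRank = W.mordellWeilRank := by
  have ht' : V.shaCorank p₀ = 0 := (shaCorank_eq_zero_iff_of_smul_eq W V C hC p₀).mp ht
  have h := analyticRank_eq_mordellWeilRank_of_admissibleDoor hX2 hX3 hK V p₀ h5 hgood hord ht'
  rw [← mordellWeilRank_eq_of_smul_eq W V C hC, ← hC, analyticRank_smul] at h
  exact h

/-! ## §1 CLASS-WIDE: every elliptic curve over `ℚ` with a rational point of prime order `p ≥ 5` -/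

/-- **A rational point of prime order `p ≥ 3` at a prime of good reduction makes `p` ORDINARY** — indeed
anomalous, `a_p ≡ 1 (mod p)` (tree `dvd_frobeniusTrace_sub_one_of_addOrderOf_eq`: the torsion point survives
reduction, `p ∣ #Ẽ(𝔽_p) = p + 1 − a_p`), so `p ∤ a_p`. In particular `3`, `5`, `7` are ordinary for the rational
`3`-, `5`-, `7`-torsion classes (global minimal model `W`). [cite: Mazur1972, §1] [cite: SilvermanAEC2009, VII.3.1(b)] -/
theorem isOrdinaryAt_of_addOrderOf_eq_prime (W : WeierstrassCurve ℚ) [W.IsElliptic] [W.IsGloballyMinimal]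
    (p : ℕ) [Fact p.Prime] (hp : 3 ≤ p) (P : W.toAffine.Point) (hP : addOrderOf P = p)
    (hgood : W.HasGoodReductionAtPrime p) : IsOrdinaryAt W p := by
  refine ⟨hgood, fun hdvd ↦ ?_⟩
  have h1 := dvd_frobeniusTrace_sub_one_of_addOrderOf_eq W p hp hgood hP
  have h : (p : ℤ) ∣ 1 := by
    have h2 := dvd_sub hdvd h1
    rwa [sub_sub_cancel] at h2
  have hp1 : (p : ℤ) ≤ 1 := Int.le_of_dvd one_pos h
  have h3 : (3 : ℤ) ≤ p := by exact_mod_cast hp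
  omega

/-- **THE TRANSFER IS IDLE ON THE RATIONAL `p`-TORSION CLASS, `p ≥ 5`** (global minimal model): for every
elliptic `W/ℚ` with a rational point of prime order `p ≥ 5`, good reduction at `p` and an open door at `p`
(`t_p(W) = 0`), the route's items X2 + X3 + Kato give `r_an(W) = rank W(ℚ)` — the door prime is X2-admissible
(`isOrdinaryAt_of_addOrderOf_eq_prime`), so §0 applies; `T = FiniteShaComponentTransfer` and `O` are not
invoked. (By Mazur's torsion theorem only `p ∈ {5, 7}` occur; the statement is uniform and uses no Kubert–Tate
model.) CONDITIONAL on `hX2`, `hX3`, `hK`. [cite: GreenbergLNM1716, §1 (pp. 54–57)] [cite: Kato2004Asterisque, Thm. 17.4]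
[cite: Mazur1972, §1] -/
theorem analyticRank_eq_mordellWeilRank_of_addOrderOf_eq_prime (hX2 : AnalyticRankLeSelmerCorank)
    (hX3 : PadicOrderLeAnalyticRankAtOnePrime) (hK : KatoRankBound)
    (W : WeierstrassCurve ℚ) [W.IsElliptic] [W.IsGloballyMinimal] (p : ℕ) [Fact p.Prime] (h5 : 5 ≤ p)
    (P : W.toAffine.Point) (hP : addOrderOf P = p) (hgood : W.HasGoodReductionAtPrime p)
    (ht : W.shaCorank p = 0) : W.analyticRank = W.mordellWeilRank :=
  analyticRank_eq_mordellWeilRank_of_admissibleDoor hX2 hX3 hK W p h5 hgood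
    (isOrdinaryAt_of_addOrderOf_eq_prime W p (by omega) P hP hgood).2 ht

/-- **… on ANY model**: the same for an arbitrary elliptic `W/ℚ` (not necessarily minimal) — a global minimal
model `C • W` exists (tree `hasGlobalMinimalModel_rat_holds`, AEC VIII.8.3), the torsion point, good reduction
at `p` and `t_p = 0` move along `C`, and `r_an`, rank come back. CONDITIONAL on `hX2`, `hX3`, `hK`.
[cite: GreenbergLNM1716, §1 (pp. 54–57)] [cite: SilvermanAEC2009, Cor. VIII.8.3 and III.3.1(b)] -/
theorem analyticRank_eq_mordellWeilRank_of_addOrderOf_eq_prime' (hX2 : AnalyticRankLeSelmerCorank)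
    (hX3 : PadicOrderLeAnalyticRankAtOnePrime) (hK : KatoRankBound)
    (W : WeierstrassCurve ℚ) [W.IsElliptic] (p : ℕ) [Fact p.Prime] (h5 : 5 ≤ p)
    (P : W.toAffine.Point) (hP : addOrderOf P = p) (hgood : W.HasGoodReductionAtPrime p)
    (ht : W.shaCorank p = 0) : W.analyticRank = W.mordellWeilRank := by
  obtain ⟨C, hC⟩ := hasGlobalMinimalModel_rat_holds W
  haveI : (C • W).IsGloballyMinimal := hC
  have hP' : addOrderOf (VariableChange.pointEquiv W C P) = p := by rw [AddEquiv.addOrderOf_eq]; exact hP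
  have hgood' : (C • W).HasGoodReductionAtPrime p := (hasGoodReductionAtPrime_iff_of_variableChange W C p).mpr hgood
  exact analyticRank_eq_mordellWeilRank_of_admissibleDoor_of_smul_eq hX2 hX3 hK W (C • W) C rfl p h5 hgood'
    (isOrdinaryAt_of_addOrderOf_eq_prime (C • W) p (by omega) _ hP' hgood').2 ht

/-- **The `5`-torsion class** (any model): rational point of order `5`, good reduction at `5`, `t₅(W) = 0` ⟹
`r_an(W) = rank W(ℚ)` from X2 + X3 + Kato, no transfer (here `a₅(W) ∈ {1, −4}` by `…RowAtFiveClassWide`).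
CONDITIONAL on `hX2`, `hX3`, `hK`. [cite: GreenbergLNM1716, §1 (pp. 54–57)] [cite: Kubert1976, Table 3 (N = 5)] -/
theorem analyticRank_eq_mordellWeilRank_of_addOrderOf_eq_five (hX2 : AnalyticRankLeSelmerCorank)
    (hX3 : PadicOrderLeAnalyticRankAtOnePrime) (hK : KatoRankBound)
    (W : WeierstrassCurve ℚ) [W.IsElliptic] (P : W.toAffine.Point) (hP : addOrderOf P = 5)
    (hgood : W.HasGoodReductionAtPrime 5) (ht : W.shaCorank 5 = 0) :
    W.analyticRank = W.mordellWeilRank :=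
  analyticRank_eq_mordellWeilRank_of_addOrderOf_eq_prime' hX2 hX3 hK W 5 le_rfl P hP hgood ht

/-- **The `7`-torsion class** (any model): rational point of order `7`, good reduction at `7`, `t₇(W) = 0` ⟹
`r_an(W) = rank W(ℚ)` from X2 + X3 + Kato, no transfer (here `a₇(W) = 1` by `…RowAtSevenClassWide`).
CONDITIONAL on `hX2`, `hX3`, `hK`. [cite: GreenbergLNM1716, §1 (pp. 54–57)] [cite: Kubert1976, Table 3 (N = 7)] -/
theorem analyticRank_eq_mordellWeilRank_of_addOrderOf_eq_seven (hX2 : AnalyticRankLeSelmerCorank)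
    (hX3 : PadicOrderLeAnalyticRankAtOnePrime) (hK : KatoRankBound)
    (W : WeierstrassCurve ℚ) [W.IsElliptic] (P : W.toAffine.Point) (hP : addOrderOf P = 7)
    (hgood : W.HasGoodReductionAtPrime 7) (ht : W.shaCorank 7 = 0) :
    W.analyticRank = W.mordellWeilRank :=
  analyticRank_eq_mordellWeilRank_of_addOrderOf_eq_prime' hX2 hX3 hK W 7 (by norm_num) P hP hgood ht

/-! ## §2 What is left of `T` for the assembly: the transfer FROM INADMISSIBLE door primes only -/

/-- `T` implies the transfer from inadmissible door primes (`p₀ < 5`, bad, or supersingular) — specialisation. [folklore] -/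
theorem transferFromInadmissible_of_finiteShaComponentTransfer (hT : FiniteShaComponentTransfer) :
    ∀ (W : WeierstrassCurve ℚ) [W.IsElliptic] [W.IsGloballyMinimal] (p₀ q : ℕ) [Fact p₀.Prime] [Fact q.Prime],
      ¬ (5 ≤ p₀ ∧ W.HasGoodReductionAtPrime p₀ ∧ ¬ (p₀ : ℤ) ∣ W.frobeniusTrace p₀) →
      5 ≤ q → W.HasGoodReductionAtPrime q → ¬ (q : ℤ) ∣ W.frobeniusTrace q →
      W.shaCorank p₀ = 0 → W.shaCorank q = 0 :=
  fun W _ _ p₀ q _ _ _ _ _ _ h0 => hT W p₀ q h0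

/-- **KatoTransfer's X1 (`ShaCorankZeroAtOnePrime`, stmt-18411) from the door `O` and the transfer FROM
INADMISSIBLE door primes alone**: an admissible open door IS X1 for that curve; an inadmissible one (`p₀ ∈ {2, 3}`,
bad or supersingular) is moved by `hTi` to a good ordinary prime `≥ 5`, which exists (ordinary primes have
density one for non-CM and one half for CM curves; tree `infinite_goodOrdinaryPrimes_holds`). So the symmetric
crux `T` enters the route only through this slice — the «TransferToSmallPrime» direction of the route header,
read FROM the small prime. CONDITIONAL on `hTi` and `hO`. [cite: Serre1981, §8] [folklore] -/
theorem shaCorankZeroAtOnePrime_of_door_of_transferFromInadmissible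
    (hTi : ∀ (W : WeierstrassCurve ℚ) [W.IsElliptic] [W.IsGloballyMinimal] (p₀ q : ℕ) [Fact p₀.Prime]
      [Fact q.Prime], ¬ (5 ≤ p₀ ∧ W.HasGoodReductionAtPrime p₀ ∧ ¬ (p₀ : ℤ) ∣ W.frobeniusTrace p₀) →
      5 ≤ q → W.HasGoodReductionAtPrime q → ¬ (q : ℤ) ∣ W.frobeniusTrace q →
      W.shaCorank p₀ = 0 → W.shaCorank q = 0)
    (hO : OneFiniteShaComponent) : ShaCorankZeroAtOnePrime := by
  intro W _ _
  obtain ⟨p₀, hp₀, h0⟩ := hO W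
  by_cases hadm : 5 ≤ p₀ ∧ W.HasGoodReductionAtPrime p₀ ∧ ¬ (p₀ : ℤ) ∣ W.frobeniusTrace p₀
  · exact ⟨p₀, hp₀, hadm.1, hadm.2.1, hadm.2.2, h0⟩
  · obtain ⟨q, hq, h5, hgood, hord⟩ :=
      exists_good_ordinary_prime_of_infinite infinite_goodOrdinaryPrimes_holds W
    exact ⟨q, hq, h5, hgood, hord, hTi W p₀ q hadm h5 hgood hord h0⟩

/-- **The assembly of route `ShaPrimaryTransfer` needs the transfer only FROM INADMISSIBLE door primes**:
`hTi → O → X2 → X3 → KatoRankBound → BSD` — sharper than `…AssemblyWeakTransfer.bsd_of_weakTransfer` (door ⟹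
every admissible prime): whenever the descent door sits at a good ordinary `p₀ ≥ 5` (§1: every rational `5`- or
`7`-torsion curve with good reduction there) no transfer is used at all (§0), otherwise one transfer from the
inadmissible `p₀` to the prime of X3. Proof: X1 by the previous theorem on a global minimal model `C • W`, then
§0. CONDITIONAL on the five hypotheses; nothing here proves any of them.
[cite: GreenbergLNM1716, §1 (pp. 54–57)] [cite: Kato2004Asterisque, Thm. 17.4] [cite: SilvermanAEC2009, Cor. VIII.8.3] -/
theorem bsd_of_transferFromInadmissible
    (hTi : ∀ (W : WeierstrassCurve ℚ) [W.IsElliptic] [W.IsGloballyMinimal] (p₀ q : ℕ) [Fact p₀.Prime]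
      [Fact q.Prime], ¬ (5 ≤ p₀ ∧ W.HasGoodReductionAtPrime p₀ ∧ ¬ (p₀ : ℤ) ∣ W.frobeniusTrace p₀) →
      5 ≤ q → W.HasGoodReductionAtPrime q → ¬ (q : ℤ) ∣ W.frobeniusTrace q →
      W.shaCorank p₀ = 0 → W.shaCorank q = 0)
    (hO : OneFiniteShaComponent) (hX2 : AnalyticRankLeSelmerCorank) (hX3 : PadicOrderLeAnalyticRankAtOnePrime)
    (hK : KatoRankBound) : _root_.BirchSwinnertonDyer := by
  intro W hW
  obtain ⟨C, hC⟩ := hasGlobalMinimalModel_rat_holds W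
  haveI : (C • W).IsGloballyMinimal := hC
  obtain ⟨p, hp, h5, hgood, hord, h0⟩ :=
    shaCorankZeroAtOnePrime_of_door_of_transferFromInadmissible hTi hO (C • W)
  haveI := hp
  exact analyticRank_eq_mordellWeilRank_of_admissibleDoor_of_smul_eq hX2 hX3 hK W (C • W) C rfl p h5 hgood hord
    ((shaCorank_eq_zero_iff_of_smul_eq W (C • W) C rfl p).mpr h0)

-- `closes` factors through §2: `bsd_of_transferFromInadmissible (transferFromInadmissible_of_… hT) hO hX2 hX3 hK`.
example (hT : FiniteShaComponentTransfer) (hO : OneFiniteShaComponent) (hX2 : AnalyticRankLeSelmerCorank)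
    (hX3 : PadicOrderLeAnalyticRankAtOnePrime) (hK : KatoRankBound) : _root_.BirchSwinnertonDyer :=
  bsd_of_transferFromInadmissible (transferFromInadmissible_of_finiteShaComponentTransfer hT) hO hX2 hX3 hK

/-- **Weakest form**: it even suffices that an inadmissible open door yields SOME admissible open door on the
same curve (`∃ q` instead of `∀ q`) — then `O` gives KatoTransfer's X1 verbatim, and `Theses.KatoTransfer.closes`
(or §0) gives BSD from X2 + X3 + Kato. This `∃`-slice of `T`, on global minimal models, is the EXACT residue of the
crux that the route's assembly consumes. CONDITIONAL on `hTe` and `hO`. [folklore] -/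
theorem shaCorankZeroAtOnePrime_of_door_of_exists_transfer
    (hTe : ∀ (W : WeierstrassCurve ℚ) [W.IsElliptic] [W.IsGloballyMinimal] (p₀ : ℕ) [Fact p₀.Prime],
      ¬ (5 ≤ p₀ ∧ W.HasGoodReductionAtPrime p₀ ∧ ¬ (p₀ : ℤ) ∣ W.frobeniusTrace p₀) → W.shaCorank p₀ = 0 →
      ∃ (q : ℕ) (_ : Fact q.Prime), 5 ≤ q ∧ W.HasGoodReductionAtPrime q ∧ ¬ (q : ℤ) ∣ W.frobeniusTrace q ∧
        W.shaCorank q = 0)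
    (hO : OneFiniteShaComponent) : ShaCorankZeroAtOnePrime := by
  intro W _ _
  obtain ⟨p₀, hp₀, h0⟩ := hO W
  by_cases hadm : 5 ≤ p₀ ∧ W.HasGoodReductionAtPrime p₀ ∧ ¬ (p₀ : ℤ) ∣ W.frobeniusTrace p₀
  · exact ⟨p₀, hp₀, hadm.1, hadm.2.1, hadm.2.2, h0⟩
  · exact hTe W p₀ hadm h0

/-- BSD from the `∃`-slice: `hTe → O → X2 → X3 → KatoRankBound → BSD` (X1 on a global minimal model, then §0).
CONDITIONAL on the five hypotheses. [cite: GreenbergLNM1716, §1 (pp. 54–57)] [cite: Kato2004Asterisque, Thm. 17.4] -/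
theorem bsd_of_exists_transfer
    (hTe : ∀ (W : WeierstrassCurve ℚ) [W.IsElliptic] [W.IsGloballyMinimal] (p₀ : ℕ) [Fact p₀.Prime],
      ¬ (5 ≤ p₀ ∧ W.HasGoodReductionAtPrime p₀ ∧ ¬ (p₀ : ℤ) ∣ W.frobeniusTrace p₀) → W.shaCorank p₀ = 0 →
      ∃ (q : ℕ) (_ : Fact q.Prime), 5 ≤ q ∧ W.HasGoodReductionAtPrime q ∧ ¬ (q : ℤ) ∣ W.frobeniusTrace q ∧
        W.shaCorank q = 0)
    (hO : OneFiniteShaComponent) (hX2 : AnalyticRankLeSelmerCorank) (hX3 : PadicOrderLeAnalyticRankAtOnePrime)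
    (hK : KatoRankBound) : _root_.BirchSwinnertonDyer := by
  intro W hW
  obtain ⟨C, hC⟩ := hasGlobalMinimalModel_rat_holds W
  haveI : (C • W).IsGloballyMinimal := hC
  obtain ⟨p, hp, h5, hgood, hord, h0⟩ := shaCorankZeroAtOnePrime_of_door_of_exists_transfer hTe hO (C • W)
  haveI := hp
  exact analyticRank_eq_mordellWeilRank_of_admissibleDoor_of_smul_eq hX2 hX3 hK W (C • W) C rfl p h5 hgood hord
    ((shaCorank_eq_zero_iff_of_smul_eq W (C • W) C rfl p).mpr h0)

end Summit.BirchSwinnertonDyer.BirchSwinnertonDyer.Theorems.ShaPrimaryTransferAdmissibleDoor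

end
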